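import Mathlib
import Literature.GroupTheory.PermutationGroups.SmallIndexSubgroups

/-!
# Entropy support theorem, layer 5: transport along the translates of a block

Helper file for stub `entropySupportTheorem` of crux `SymmetryBudget.WindowBarrier`
(item stmt-PneNP-2145, line `bijection-gauge-twin-iso`).  For a subgroup `M ≤ Sym(β)` normalised
by `T ≤ Sym(β)` and a finite set `B`, being trivial on `B` / full on `B` (every even permutation
supported in `B` agrees on `B` with an element of `M`) / without non-trivial elements supported in
`B` / containing all even permutations supported in `B` propagates to every translate `t • B`,
`t ∈ T` (`est_transport_full` and its relatives), by conjugation.  No definitions.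
-/

-- `Summit.PneNP.PneNP.…` duplicates `PneNP` BY DESIGN (single-problem summit).
set_option linter.dupNamespace false

namespace Summit.PneNP.PneNP.Theorems

open Equiv Equiv.Perm MulAction Subgroup
open Literature.GroupTheory.PermutationGroups (perm_apply_inv_self perm_inv_apply_self)
open scoped Pointwise

namespace EST

variable {β : Type*} [Fintype β] [DecidableEq β]

omit [Fintype β] in
/-- Elements of the orbit of a finite set under a subgroup of `Sym(β)` are translates. -/
theorem exists_smul_eq_of_mem_orbit (T : Subgroup (Perm β)) (B : Finset β) {C : Finset β}
    (hC : C ∈ orbit T B) : ∃ g ∈ T, g • B = C := by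
  obtain ⟨t, rfl⟩ := mem_orbit_iff.1 hC
  exact ⟨t, t.2, rfl⟩

omit [Fintype β] in
/-- Conjugating into the block: if `g • B = C` then `g⁻¹ u ∈ B ↔ u ∈ C`. -/
theorem inv_apply_mem_iff_of_smul_eq {g : Perm β} {B C : Finset β} (h : g • B = C) (u : β) :
    g⁻¹ u ∈ B ↔ u ∈ C := by
  rw [← h, ← Finset.inv_smul_mem_iff]; rfl

omit [Fintype β] in
/-- If `g • B = C` then `g u ∈ C ↔ u ∈ B`. -/
theorem apply_mem_iff_of_smul_eq {g : Perm β} {B C : Finset β} (h : g • B = C) (u : β) :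
    g u ∈ C ↔ u ∈ B := by
  rw [← h]; exact Finset.smul_mem_smul_finset_iff g

/-- The sign of a conjugate. -/
theorem sign_inv_mul_mul (g σ : Perm β) : sign (g⁻¹ * σ * g) = sign σ := by
  simp only [map_mul, map_inv, mul_right_comm _ (sign σ), inv_mul_cancel, one_mul]

omit [Fintype β] in
/-- A permutation supported in `g • B` conjugates to one supported in `B`. -/
theorem moved_subset_of_conj {g σ : Perm β} {B C : Finset β} (h : g • B = C)
    (hσ : ∀ u, σ u ≠ u → u ∈ C) (u : β) (hu : (g⁻¹ * σ * g) u ≠ u) : u ∈ B := by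
  rw [← apply_mem_iff_of_smul_eq h]
  apply hσ
  intro e
  apply hu
  rw [Perm.mul_apply, Perm.mul_apply, e, perm_inv_apply_self]

omit [Fintype β] in
/-- **Transport of triviality**: a `T`-normalised subgroup trivial on `B` is trivial on every
translate of `B`. -/
theorem transport_trivial (T : Subgroup (Perm β)) (B : Finset β) (M : Subgroup (Perm β))
    (hnorm : ∀ t ∈ T, ∀ m ∈ M, t * m * t⁻¹ ∈ M) (h : ∀ m ∈ M, ∀ u ∈ B, m u = u) :
    ∀ C ∈ orbit T B, ∀ m ∈ M, ∀ u ∈ C, m u = u := by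
  intro C hC m hm u hu
  obtain ⟨g, hg, hgC⟩ := exists_smul_eq_of_mem_orbit T B hC
  have hm' : g⁻¹ * m * g ∈ M := by
    have := hnorm g⁻¹ (T.inv_mem hg) m hm
    rwa [inv_inv] at this
  have h1 := h _ hm' (g⁻¹ u) ((inv_apply_mem_iff_of_smul_eq hgC u).2 hu)
  rw [Perm.mul_apply, Perm.mul_apply, perm_apply_inv_self] at h1
  exact g⁻¹.injective h1

omit [Fintype β] in
/-- **Transport of rigid triviality**: if the only element of a `T`-normalised `M` trivial off
`B` is `1`, the same holds for every translate of `B`. -/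
theorem transport_rigid_trivial (T : Subgroup (Perm β)) (B : Finset β) (M : Subgroup (Perm β))
    (hnorm : ∀ t ∈ T, ∀ m ∈ M, t * m * t⁻¹ ∈ M)
    (h : ∀ z ∈ M, (∀ u, u ∉ B → z u = u) → z = 1) :
    ∀ C ∈ orbit T B, ∀ z ∈ M, (∀ u, u ∉ C → z u = u) → z = 1 := by
  intro C hC z hz hzC
  obtain ⟨g, hg, hgC⟩ := exists_smul_eq_of_mem_orbit T B hC
  have hz' : g⁻¹ * z * g ∈ M := by
    have := hnorm g⁻¹ (T.inv_mem hg) z hz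
    rwa [inv_inv] at this
  have h1 : g⁻¹ * z * g = 1 := by
    refine h _ hz' fun u hu => ?_
    have hgu : g u ∉ C := fun e => hu ((apply_mem_iff_of_smul_eq hgC u).1 e)
    rw [Perm.mul_apply, Perm.mul_apply, hzC _ hgu, perm_inv_apply_self]
  have e : z = g * (g⁻¹ * z * g) * g⁻¹ := by group
  rw [e, h1, mul_one, mul_inv_cancel]

end EST

open EST in
/-- **Transport of fullness**: let `M ≤ Sym(β)` be normalised by `T` and *full* on the finite
set `B` (every even permutation supported in `B` agrees on `B` with an element of `M`).  Then `M`
is full on every translate `C = t • B`, `t ∈ T` (conjugate by `t`). -/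
theorem est_transport_full :
    ∀ {β : Type*} [Fintype β] [DecidableEq β] (T : Subgroup (Equiv.Perm β)) (B : Finset β)
      (M : Subgroup (Equiv.Perm β)), (∀ t ∈ T, ∀ m ∈ M, t * m * t⁻¹ ∈ M) →
      (∀ σ : Equiv.Perm β, Equiv.Perm.sign σ = 1 → (∀ u, σ u ≠ u → u ∈ B) →
        ∃ m ∈ M, ∀ u ∈ B, m u = σ u) →
      ∀ C ∈ MulAction.orbit T B, ∀ σ : Equiv.Perm β, Equiv.Perm.sign σ = 1 →
        (∀ u, σ u ≠ u → u ∈ C) → ∃ m ∈ M, ∀ u ∈ C, m u = σ u := by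
  intro β _ _ T B M hnorm h C hC σ hσ hσC
  obtain ⟨g, hg, hgC⟩ := exists_smul_eq_of_mem_orbit T B hC
  obtain ⟨m, hm, hmσ⟩ := h (g⁻¹ * σ * g) (by rw [sign_inv_mul_mul, hσ]) (moved_subset_of_conj hgC hσC)
  refine ⟨g * m * g⁻¹, hnorm g hg m hm, fun u hu => ?_⟩
  have h1 := hmσ (g⁻¹ u) ((inv_apply_mem_iff_of_smul_eq hgC u).2 hu)
  rw [Perm.mul_apply, Perm.mul_apply, perm_apply_inv_self] at h1
  rw [Perm.mul_apply, Perm.mul_apply, h1, perm_apply_inv_self]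

open EST in
/-- **Transport of rigid fullness**: if a `T`-normalised `M` contains every even permutation
supported in `B`, it contains every even permutation supported in any translate of `B`. -/
theorem est_transport_rigid_full :
    ∀ {β : Type*} [Fintype β] [DecidableEq β] (T : Subgroup (Equiv.Perm β)) (B : Finset β)
      (M : Subgroup (Equiv.Perm β)), (∀ t ∈ T, ∀ m ∈ M, t * m * t⁻¹ ∈ M) →
      (∀ σ : Equiv.Perm β, Equiv.Perm.sign σ = 1 → (∀ u, σ u ≠ u → u ∈ B) → σ ∈ M) →
      ∀ C ∈ MulAction.orbit T B, ∀ σ : Equiv.Perm β, Equiv.Perm.sign σ = 1 →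
        (∀ u, σ u ≠ u → u ∈ C) → σ ∈ M := by
  intro β _ _ T B M hnorm h C hC σ hσ hσC
  obtain ⟨g, hg, hgC⟩ := exists_smul_eq_of_mem_orbit T B hC
  have h1 := h (g⁻¹ * σ * g) (by rw [sign_inv_mul_mul, hσ]) (moved_subset_of_conj hgC hσC)
  have e : σ = g * (g⁻¹ * σ * g) * g⁻¹ := by group
  rw [e]
  exact hnorm g hg _ h1

end Summit.PneNP.PneNP.Theorems
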